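import Literature.NumberTheory.EllipticCurves.Kato2004.IwasawaH1ReductionTower
import Literature.NumberTheory.EllipticCurves.IwasawaTwistModPShapiroConj
import HarnessLib

/-!
# The `Ω`-adic class of `T · x`: `red_Ω (T x) = ((1+T)^{−1} − 1) · red_Ω x` levelwise — the
# `Λ`-action `T = conj_γ − 1` of the pinned `𝐇¹_Γ(T_pW)` read in the `T`-adic tower through the
# Shapiro dictionary (definitions + proofs; no fact)

Topic `NumberTheory/EllipticCurves`, sub-directory `Kato2004`.  Cell `bsd-smallim` (rung K6 of
`BirchSwinnertonDyer`, crux `MuTransferX9` = item 19276, open stub `stub_coreX9`), seat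
`bsd-smallim-k6-ty` (typer), CORE-PLAN S0.4/S2.1: companion of `IwasawaH1ReductionTower.lean`
(`IwasawaH1Data.redTower : 𝐇¹_Γ(T_pW) → twistTower`) and `IwasawaTwistModPShapiroConj.lean`
(`coresShapiro ∘ conj_γ = H¹((1+S)^{p^n−1}) ∘ coresShapiro`).

* (generic `ZpExtension`) `truncH1_unipotentH1` — truncation commutes with `H¹((1+S)^a)`;
  `unipotentH1_zero`, `unipotentH1_succ` — `H¹((1+S)^0) = id`,
  `H¹((1+S)^{a+1}) = H¹((1+S)^a) + T ∘ H¹((1+S)^a)` (`T = shiftH1`): so `H¹((1+S)^a) − id` is `T` times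
  a polynomial in `T`, i.e. `(1+T)^a` in `End(H¹(K, 𝒯_J))`.
* (`Kato2004.IwasawaH1Data`) **`redTower_X_smul_coe`**: for the pinned datum `I : IwasawaH1Data W p κ γ`
  with `γ` a topological generator of `κ` and `x ∈ I.H`, levelwise in `H¹(ℚ, 𝒯_J(E))`:
  `(red_Ω (X • x))_J = H¹((1+S)^{p^J − 1}) (red_Ω x)_J − (red_Ω x)_J`
  (`X = T ∈ Λ` acts as `conj_γ − 1`, `IwasawaH1Data.proj_T_smul`; `(1+S)^{p^J−1} = (1+T)^{−1}` on
  `𝒯_J`, `J ≤ p^J`).  Hence `red_Ω ∘ T = ((1+T)^{−1} − 1) ∘ red_Ω = (−T (1+T)^{−1}) ∘ red_Ω`: the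
  `Ω`-adic class map is `Λ → Ω`-semilinear up to the unit `−(1+T)^{−1}`, which is all the `ord_T`
  bookkeeping of MU-TRANSFER-PROOF Step 0 ((F4)) needs.

## References

* K. Kato, Astérisque 295 (2004), §12.2 (p. 220), §13.8 (pp. 228–229). [Kato2004Asterisque]
* L. Washington, *Introduction to Cyclotomic Fields* (1997), §13.1–§13.2 (`T = γ − 1`). [Washington1997]
* J.-P. Serre, *Galois Cohomology* (1997), I §2.5. [SerreGaloisCohomology1997]
-/

noncomputable section

open scoped NumberField
open Field CategoryTheory
open Literature.NumberTheory.GaloisRepresentations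
open Literature.NumberTheory.EllipticCurves Literature.NumberTheory.EllipticCurves.Kato2004
open Literature.NumberTheory.EllipticCurves.Kato2004.EulerSystemValues
open WeierstrassCurve (geomPoints geomTorsion)

universe u

/-! ## `H¹((1+S)^a)` on `H¹(K, 𝒯_J)`: truncation, and the recursion in `T` -/

namespace Literature.NumberTheory.EllipticCurves.ZpExtension

variable {K : Type u} [Field K] {p : ℕ} [Fact p.Prime] (κ : ZpExtension K p)
variable {M : Type u} [AddCommGroup M] [TopologicalSpace M] [DiscreteTopology M]
variable (ρ : DiscreteGaloisModule K M) (hM : ∀ x : M, p • x = 0) (J : ℕ)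

/-- **Truncation commutes with `H¹((1+S)^a)`**: `trunc_{J' ← J} ∘ H¹((1+S)^a on 𝒯_J) =
H¹((1+S)^a on 𝒯_{J'}) ∘ trunc_{J' ← J}` (both induced by `x ↦ ((1+S)^a x) mod T^{J'}`,
`unipotentPow_comp_castLE`). [cite: Washington1997, §13.1–§13.2] -/
theorem truncH1_unipotentH1 {J' : ℕ} (h : J' ≤ J) (a : ℕ) (c : galoisCohomology (κ.twistModP ρ hM J) 1) :
    κ.truncH1 ρ hM h (κ.unipotentH1 ρ hM J a c) = κ.unipotentH1 ρ hM J' a (κ.truncH1 ρ hM h c) := by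
  unfold truncH1 unipotentH1
  rw [κ.map_map_twist ρ hM J _ _ ((κ.twistModPTruncate ρ hM J h).comp (κ.twistModPUnipotent ρ hM J a))
      (fun _ ↦ rfl),
    κ.map_map_twist ρ hM J _ _ ((κ.twistModPUnipotent ρ hM J' a).comp (κ.twistModPTruncate ρ hM J h))
      (fun _ ↦ rfl)]
  refine κ.map_eq_map_of_coe_eq ρ hM J _ _ (fun x ↦ ?_) c
  change (fun i ↦ unipotentPow M J a x (Fin.castLE h i)) =
    unipotentPow M J' a (fun i ↦ x (Fin.castLE h i))
  exact unipotentPow_comp_castLE J h a x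

/-- `H¹((1+S)^0) = id`. [cite: Washington1997, §13.1–§13.2] -/
theorem unipotentH1_zero (c : galoisCohomology (κ.twistModP ρ hM J) 1) :
    κ.unipotentH1 ρ hM J 0 c = c := by
  obtain ⟨φ, rfl⟩ := oneCocycleClass_surjective _ c
  rw [unipotentH1_apply, map_oneCocycleClass_twist]
  exact congrArg _ (Subtype.ext (ContinuousMap.ext fun σ ↦ by
    rw [pushCocycle_apply, twistModPUnipotent_apply, unipotentPow_zero, Module.End.one_apply]))

/-- **The recursion `H¹((1+S)^{a+1}) = H¹((1+S)^a) + T · H¹((1+S)^a)`** on `H¹(K, 𝒯_J)`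
(`T = shiftH1`; from `(1+S)^{a+1} y = (1+S)^a y + S (1+S)^a y`): `H¹((1+S)^a)` is the operator
`(1 + T)^a`, so `H¹((1+S)^a) − id ∈ T · ℤ[T]`. [cite: Washington1997, §13.1–§13.2] -/
theorem unipotentH1_succ (a : ℕ) (c : galoisCohomology (κ.twistModP ρ hM J) 1) :
    κ.unipotentH1 ρ hM J (a + 1) c =
      κ.unipotentH1 ρ hM J a c + κ.shiftH1 ρ hM J (κ.unipotentH1 ρ hM J a c) := by
  obtain ⟨φ, rfl⟩ := oneCocycleClass_surjective _ c
  rw [unipotentH1_apply, unipotentH1_apply, map_oneCocycleClass_twist, map_oneCocycleClass_twist,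
    shiftH1, map_oneCocycleClass_twist]
  refine Eq.trans ?_ (oneCocycleClass_add (κ.twistModP ρ hM J).toTopRep _ _)
  exact congrArg _ (Subtype.ext (ContinuousMap.ext fun σ ↦ by
    rw [Submodule.coe_add, ContinuousMap.add_apply, pushCocycle_apply, pushCocycle_apply,
      pushCocycle_apply, pushCocycle_apply, twistModPUnipotent_apply, twistModPUnipotent_apply,
      twistModPShift_apply, unipotentPow_succ_apply]))

end Literature.NumberTheory.EllipticCurves.ZpExtension

/-! ## `red_Ω (T · x)` on the pinned `𝐇¹_Γ(T_pW)` -/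

namespace Literature.NumberTheory.EllipticCurves.Kato2004

namespace IwasawaH1Data

variable {W : WeierstrassCurve ℚ} [W.IsElliptic] {p : ℕ} [Fact p.Prime]
  [ContinuousSMul ℤ_[p] (W.tateModule p)] {κ : ZpExtension ℚ p} {γ : absoluteGaloisGroup ℚ}
  (I : IwasawaH1Data W p κ γ)

/-- **`red_Ω (T · x) = ((1+T)^{−1} − 1) · red_Ω x`, levelwise.**  For the pinned datum
`I : IwasawaH1Data W p κ γ` with `γ` a topological generator of `κ` (`κ γ = 1`; `X = T ∈ Λ = ℤ_p⟦T⟧`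
acts on `𝐇¹_Γ(T_pW)` as `conj_γ − 1`, `proj_T_smul`) and `x ∈ I.H`, the `J`-th component of the
`Ω`-adic class of `T · x` is `H¹((1+S)^{p^J − 1}) (red_Ω x)_J − (red_Ω x)_J` in `H¹(ℚ, 𝒯_J(E))`, where
`(1+S)^{p^J−1} = (1+T)^{−1}` on `𝒯_J` (`J ≤ p^J`).  Ingredients: `red_X_smul` (`red (T x) = (conj_γ − 1)
red x`), the dictionary `coresShapiro ∘ conj_γ = H¹((1+S)^{p^J−1}) ∘ coresShapiro`
(`coresShapiro_conjMap_of_isTopGenerator`) and `truncH1_unipotentH1`.  With `unipotentH1_succ` this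
exhibits `red_Ω ∘ T` as `(unit) · towerShift ∘ red_Ω` levelwise.
[cite: Kato2004Asterisque, §13.8 (pp. 228–229)] [cite: Washington1997, §13.1–§13.2] -/
theorem redTower_X_smul_coe (hγ : κ.IsTopGenerator γ) (x : I.H) (J : ℕ) :
    (I.redTower ((PowerSeries.X : IwasawaAlgebra p) • x) : ∀ J : ℕ,
        galoisCohomology (κ.twistModP (W.torsionGaloisModule (p : ℤ)) torsion_nsmul_eq_zero J) 1) J =
      κ.unipotentH1 (W.torsionGaloisModule (p : ℤ)) torsion_nsmul_eq_zero J (p ^ J - 1)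
          ((I.redTower x : ∀ J : ℕ,
            galoisCohomology (κ.twistModP (W.torsionGaloisModule (p : ℤ)) torsion_nsmul_eq_zero J) 1) J) -
        (I.redTower x : ∀ J : ℕ,
          galoisCohomology (κ.twistModP (W.torsionGaloisModule (p : ℤ)) torsion_nsmul_eq_zero J) 1) J := by
  letI := κ.fintypeQuotientLayer J
  rw [redTower_apply_coe, redTower_apply_coe]
  change κ.truncH1 _ _ _ (κ.coresShapiro _ _ J (I.red ((PowerSeries.X : IwasawaAlgebra p) • x) J)) =
    κ.unipotentH1 _ _ J (p ^ J - 1) (κ.truncH1 _ _ _ (κ.coresShapiro _ _ J (I.red x J))) -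
      κ.truncH1 _ _ _ (κ.coresShapiro _ _ J (I.red x J))
  rw [I.red_X_smul x J, map_sub, map_sub,
    κ.coresShapiro_conjMap_of_isTopGenerator (W.torsionGaloisModule (p : ℤ)) torsion_nsmul_eq_zero J hγ,
    κ.truncH1_unipotentH1]

end IwasawaH1Data

end Literature.NumberTheory.EllipticCurves.Kato2004

end
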